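import Literature.MathematicalPhysics.QuantumFieldTheory.Dimock2011to13.SmallFieldFlow
import Literature.MathematicalPhysics.QuantumFieldTheory.Dimock2011to13.EndChainRegime

/-!
# The parameter regime of the kernel flow `SmallFieldFlow.flow_exists_unique` (D1 Theorem 24): the print's
`β < 1/4 − 10ε` is NECESSARY for the hypothesis structure `FlowSmall`, and — with explicit `L₀(β)`, `λ₀(L, 𝒪(1), β, ε)` —
SUFFICIENT; a non-vacuity certificate with the regime written out

**Citation header (template of the Balaban lattice Yang–Mills cell; no manuscript under audit is touched).**
J. Dimock, *The renormalization group according to Balaban. I. Small fields*, Rev. Math. Phys. **25** (2013) 1330010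
(= arXiv:1108.1335v2) [Dimock2013]: §5 *"the flow"*, Lemma 23 / Theorem 24 (\label{gsf}) and the parameter clauses of
their proofs — TeX L2880–2883 (*"L^{β−3/2} ≤ 1/4 for L large"*, *"L^{−2}λ_k^{6ε} ≤ 1/4"*, *"𝒪(1)Lλ_k^{1/4−β−4ε} ≤ 1/2 for
λ_k small (depending on L)"*), L2885–2894, L2956, L2995, and the standing bound on `β` STATED at L2803 (*"β < 1/4 − 10ε"*; USED
at L3034), quoted and discussed in the cell module `SmallFieldFlow` v1.1/v1.2 header (v), GAPS C-tmpl16-2 / C-pv11g11-2.  TeX line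
numbers refer to the cell's held source `inputs/files/dimock/src/1108.1335/1108.1335.tex` (= arXiv v2).

**Why this module.**  The lineage's `SmallFieldFlow` proves Lemma 23 and Theorem 24 from the single-step shapes
`StepBounds` and the parameter structure `FlowSmall lam Lr A eps β K`, in which EVERY *"L large / λ_k small"* of the
printed proof is a NAMED inequality (`j1`–`j3`, `e1`–`e2`, `c1`–`c2`, `half`, `lam_le_one`, `λ_{k+1} = Lλ_k`).  This leaf
settles the joint satisfiability of those inequalities, and locates the role of the printed exponent condition:
* Part 1 (NECESSITY): if `FlowSmall lam Lr A eps β K` holds and the `𝒪(1)` is not trivially small (`A·L^{3−β} > 1/2`,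
  resp. `A·L > 1/2`), then `β + 10ε < 1/4` (from `e2` at the top level), resp. `β + 4ε < 1/4` (from `j3`): the print's
  *"β < 1/4 − 10ε"* (L3034) is exactly the non-vacuity condition of the kernel's hypothesis structure — for a
  non-positive exponent `λ_K^{1/4−β−10ε} ≥ 1` on `0 < λ_K ≤ 1`, so `e2` cannot hold.
* Part 2 (SUFFICIENCY, explicit): for `0 < β`, `0 < ε`, `β + 10ε < 1/4`, `𝒪(1) = A ≥ 0`, every `L ≥ L₀(β) := max(4, 4^{1/β})`
  and every top value `0 < λ_K ≤ λ₀ := exp(−ellFlow L A ε β)` (a closed-form maximum of four logarithmic thresholds), the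
  geometric sequence `λ_k = λ_K·L^{k−K}` satisfies `FlowSmall`; hence (Part 3) Theorem 24's flow exists and is unique in
  that regime for any single step obeying `StepBounds` — *"for L sufficiently large and λ_k sufficiently small (depending
  on L)"* with the thresholds written out.

**What is proved (Mathlib + the imported cell modules only).**  `quarter10_of_flowSmall`, `quarter4_of_flowSmall`
(necessity); `lamSeq` with `lamSeq_pos`/`lamSeq_succ`/`lamSeq_top`/`lamSeq_le`; `rpow_neg_le_quarter_of_le` (`L ≥ 4^{1/β} ⟹
L^{−β} ≤ 1/4`); `ellFlow` and **`flowSmall_regime`**; `exists_flowSmall`; **`flow_exists_unique_regime`**.  The threshold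
device `expThreshold X s = log(max X 1)/s` (`X·λ^s ≤ 1 ⟸ −log λ ≥ expThreshold X s`) is REUSED BY NAME from the sibling
`EndChainRegime` v1.1 (Part 5).  [folklore] real arithmetic throughout (`Real.rpow_le_rpow`,
`Real.rpow_le_rpow_of_exponent_ge`, `Real.rpow_le_rpow_of_nonpos`, `Real.one_le_rpow_of_pos_of_le_one_of_nonpos`); nothing
of the papers is asserted.  Numeric reading (two engines — float and 40-digit decimal —, cell records GAPS C-tmpl18-3): at
`(β, ε, A) = (1/8, 1/100, 1)`: `L₀ = 4⁸ = 65 536` and at `L = L₀` the four thresholds are `log 2/β = 5.545`, `0`, `163.09`,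
`1358.57`, so `λ_K ≤ e^{−1359}`; at `(1/16, 1/100, 1)`: `L₀ = 4¹⁶`, `ellFlow = 768.40`; at `(1/8, 1/100, 10)`: `1450.67`.  The
binding clause is `e2`/`c2` (`8AL^{3−β}λ^{1/4−β−10ε} ≤ 1`); sizes are artefacts of the budget `1/4 + 1/8 + 1/8` and of taking
`L = L₀(β)`, immaterial to the qualitative statement.

**What is NOT claimed.**  Nothing about the single step (`StepBounds` stays a hypothesis shape — D1 Theorem 14 / Lemma 22
are analytic and Bałaban-dependent); no optimality of `L₀`, `λ₀`; nothing Bałaban-side (B12 Thm 2's marginal direction has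
no contraction and stays template-less, G1 / TEMPLATE §16.2).  Value = non-vacuity certificate of the template's kernel flow
with its regime and the role of `β < 1/4 − 10ε` located, NOT summit progress.

Cell records: GAPS.md C-tmpl16-2 (the flow), C-tmpl18-2 (`EndChainRegime` v1.1), this module's row C-tmpl18-3; unit
`b2b-balaban-template` gen 18 (v1.1: DOCSTRING-ONLY fold of XREAD C-pv10-84's two locator items — L2803 vs L3034; the held TeX
file name; declarations byte-identical to v1).  NEW leaf; imports `…Dimock2011to13.SmallFieldFlow` (the flow) + `…Dimock2011to13.EndChainRegime`
(the threshold device only); sub-namespace `…Dimock2011to13.SmallFieldFlowRegime`; modifies nothing.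
-/

noncomputable section

open Real

namespace Literature.MathematicalPhysics.QuantumFieldTheory.Dimock2011to13.SmallFieldFlowRegime

open Literature.MathematicalPhysics.QuantumFieldTheory.Dimock2011to13.SmallFieldFlow

/-! ## Part 1. NECESSITY of the printed exponent condition -/

/-- **`β + 10ε < 1/4` IS NECESSARY**: if the parameter structure `FlowSmall lam L A ε β K` holds and the `𝒪(1)` is not
trivially small, `A·L^{3−β} > 1/2`, then `β + 10ε < 1/4` — from the `E`-clause `e2` at the top level `k = K`: on
`0 < λ_K ≤ 1` a non-positive exponent gives `λ_K^{1/4−β−10ε} ≥ 1`.  This is the print's standing bound *"β < 1/4 − 10ε"*.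
[cite: Dimock2013, §5, the bound on β stated at arXiv:1108.1335v2 TeX L2803 and used in the proof of Theorem 24 at L3034] -/
theorem quarter10_of_flowSmall {lam : ℕ → ℝ} {Lr A eps β : ℝ} {K : ℕ} (h : FlowSmall lam Lr A eps β K)
    (hA : 1 / 2 < A * Lr ^ (3 - β)) : β + 10 * eps < 1 / 4 := by
  by_contra hc
  have hc' := not_lt.mp hc
  have hs : 1 / 4 - β - 10 * eps ≤ 0 := by linarith
  have hx := h.lam_pos K
  have hx1 := h.lam_le_one K le_rfl
  have h1 : 1 ≤ lam K ^ (1 / 4 - β - 10 * eps) := Real.one_le_rpow_of_pos_of_le_one_of_nonpos hx hx1 hs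
  have he2 := h.e2 K le_rfl
  have hALr : 0 ≤ A * Lr ^ (3 - β) := mul_nonneg h.A_nonneg (Real.rpow_nonneg h.Lr_pos.le _)
  have h2 : A * Lr ^ (3 - β) ≤ A * Lr ^ (3 - β) * lam K ^ (1 / 4 - β - 10 * eps) :=
    le_mul_of_one_le_right hALr h1
  linarith

/-- The weaker companion from the `μ`-clause `j3`: `A·L > 1/2 ⟹ β + 4ε < 1/4`. [cite: Dimock2013, §5 proof of Lemma 23 «𝒪(1)Lλ_k^{1/4−β−4ε} ≤ 1/2 for λ_k small» (arXiv:1108.1335v2 TeX L2880–2883)] -/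
theorem quarter4_of_flowSmall {lam : ℕ → ℝ} {Lr A eps β : ℝ} {K : ℕ} (h : FlowSmall lam Lr A eps β K)
    (hA : 1 / 2 < A * Lr) : β + 4 * eps < 1 / 4 := by
  by_contra hc
  have hc' := not_lt.mp hc
  have hs : 1 / 4 - β - 4 * eps ≤ 0 := by linarith
  have hx := h.lam_pos K
  have hx1 := h.lam_le_one K le_rfl
  have h1 : 1 ≤ lam K ^ (1 / 4 - β - 4 * eps) := Real.one_le_rpow_of_pos_of_le_one_of_nonpos hx hx1 hs
  have hj3 := h.j3 K le_rfl
  have hALr : 0 ≤ A * Lr := mul_nonneg h.A_nonneg h.Lr_pos.le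
  have h2 : A * Lr ≤ A * Lr * lam K ^ (1 / 4 - β - 4 * eps) := le_mul_of_one_le_right hALr h1
  linarith

/-! ## Part 2. SUFFICIENCY with explicit thresholds -/

-- The threshold device `expThreshold X s = log(max X 1)/s` («after which X·λ^s ≤ 1») is REUSED from the sibling
-- `EndChainRegime` (Part 5, v1.1) — `expThreshold`, `expThreshold_nonneg`, `mul_rpow_le_one_of_expThreshold_le`,
-- `le_neg_log_of_le_exp_neg` — rather than re-declared (gate dedup).
open Literature.MathematicalPhysics.QuantumFieldTheory.Dimock2011to13.EndChainRegime
  (expThreshold expThreshold_nonneg mul_rpow_le_one_of_expThreshold_le le_neg_log_of_le_exp_neg)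

/-- THE LEVEL SEQUENCE with prescribed top value: `λ_k = x·L^{k−K}` (so `λ_K = x`, `λ_{k+1} = Lλ_k`). [folklore] -/
def lamSeq (Lr x : ℝ) (K : ℕ) (k : ℕ) : ℝ := x * Lr ^ ((k : ℝ) - K)

/-- `λ_k > 0`. [folklore] -/
theorem lamSeq_pos {Lr x : ℝ} (hL : 0 < Lr) (hx : 0 < x) (K k : ℕ) : 0 < lamSeq Lr x K k :=
  mul_pos hx (Real.rpow_pos_of_pos hL _)

/-- `λ_{k+1} = L·λ_k`. [folklore] -/
theorem lamSeq_succ {Lr x : ℝ} (hL : 0 < Lr) (K k : ℕ) : lamSeq Lr x K (k + 1) = Lr * lamSeq Lr x K k := by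
  unfold lamSeq
  have : ((k + 1 : ℕ) : ℝ) - K = ((k : ℝ) - K) + 1 := by push_cast; ring
  rw [this, Real.rpow_add hL, Real.rpow_one]; ring

/-- `λ_K = x`. [folklore] -/
theorem lamSeq_top (Lr x : ℝ) (K : ℕ) : lamSeq Lr x K K = x := by
  simp [lamSeq]

/-- `λ_k ≤ x` for `k ≤ K` (`L ≥ 1`). [folklore] -/
theorem lamSeq_le {Lr x : ℝ} (hL : 1 ≤ Lr) (hx : 0 ≤ x) {K k : ℕ} (hk : k ≤ K) : lamSeq Lr x K k ≤ x := by
  unfold lamSeq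
  have h1 : Lr ^ ((k : ℝ) - K) ≤ 1 := by
    apply Real.rpow_le_one_of_one_le_of_nonpos hL
    have : (k : ℝ) ≤ K := by exact_mod_cast hk
    linarith
  calc x * Lr ^ ((k : ℝ) - K) ≤ x * 1 := mul_le_mul_of_nonneg_left h1 hx
    _ = x := mul_one x

/-- `L ≥ 4^{1/β} ⟹ L^{−β} ≤ 1/4` (`β > 0`): the `L`-clause of `e1`/`c2` with room to spare. [folklore] -/
theorem rpow_neg_le_quarter_of_le {Lr β : ℝ} (hβ : 0 < β) (h : (4 : ℝ) ^ (1 / β) ≤ Lr) : Lr ^ (-β) ≤ 1 / 4 := by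
  have h4 : 0 < (4 : ℝ) ^ (1 / β) := Real.rpow_pos_of_pos (by norm_num) _
  have h1 : Lr ^ (-β) ≤ ((4 : ℝ) ^ (1 / β)) ^ (-β) := Real.rpow_le_rpow_of_nonpos h4 h (by linarith)
  have h2 : ((4 : ℝ) ^ (1 / β)) ^ (-β) = 1 / 4 := by
    rw [← Real.rpow_mul (by norm_num : (0 : ℝ) ≤ 4)]
    have : 1 / β * -β = -1 := by field_simp
    rw [this, Real.rpow_neg_one]; norm_num
  rw [h2] at h1; exact h1

/-- THE EXPLICIT `−log λ_K`-THRESHOLD: `max(0, log 2/β, log(max(8/L², 1))/(6ε), log(max(16AL, 1))/(1/4−β−4ε),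
log(max(8AL^{3−β}, 1))/(1/4−β−10ε))`. [folklore] -/
def ellFlow (Lr A eps β : ℝ) : ℝ :=
  max 0 (max (expThreshold 2 β) (max (expThreshold (8 / Lr ^ 2) (6 * eps))
    (max (expThreshold (16 * A * Lr) (1 / 4 - β - 4 * eps)) (expThreshold (8 * A * Lr ^ (3 - β)) (1 / 4 - β - 10 * eps)))))

/-- **`FlowSmall` IN THE EXPLICIT REGIME (sufficiency).**  For `0 < β`, `0 < ε`, `β + 10ε < 1/4`, `A ≥ 0`, `L ≥ 4` with
`L^{−β} ≤ 1/4`, and a top value `0 < x` with `−log x ≥ ellFlow L A ε β`, the sequence `λ_k = x·L^{k−K}` satisfies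
`FlowSmall (lamSeq L x K) L A ε β K` — every clause with the budget `1/4 + 1/8 + 1/8 = 1/2`. [cite: Dimock2013, §5 proof of Lemma 23 / Theorem 24, the clauses «L large», «λ_k small (depending on L)» (arXiv:1108.1335v2 TeX L2880–2894, L2956, L2995)] -/
theorem flowSmall_regime {Lr A eps β x : ℝ} {K : ℕ} (hβ : 0 < β) (hε : 0 < eps) (hq : β + 10 * eps < 1 / 4)
    (hA : 0 ≤ A) (hL4 : 4 ≤ Lr) (hLβ : Lr ^ (-β) ≤ 1 / 4) (hx : 0 < x) (hℓ : ellFlow Lr A eps β ≤ -Real.log x) :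
    FlowSmall (lamSeq Lr x K) Lr A eps β K := by
  have hL0 : 0 < Lr := by linarith
  have hL1 : 1 ≤ Lr := by linarith
  have hs1 : 0 < 1 / 4 - β - 4 * eps := by linarith
  have hs2 : 0 < 1 / 4 - β - 10 * eps := by linarith
  have h6 : 0 < 6 * eps := by linarith
  -- unpack the thresholds
  have e0 : 0 ≤ -Real.log x := le_trans (le_max_left _ _) hℓ
  have r1 := le_trans (le_max_right _ _) hℓ
  have eβ : expThreshold 2 β ≤ -Real.log x := le_trans (le_max_left _ _) r1
  have r2 := le_trans (le_max_right _ _) r1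
  have e6 : expThreshold (8 / Lr ^ 2) (6 * eps) ≤ -Real.log x := le_trans (le_max_left _ _) r2
  have r3 := le_trans (le_max_right _ _) r2
  have e3 : expThreshold (16 * A * Lr) (1 / 4 - β - 4 * eps) ≤ -Real.log x := le_trans (le_max_left _ _) r3
  have e4 : expThreshold (8 * A * Lr ^ (3 - β)) (1 / 4 - β - 10 * eps) ≤ -Real.log x := le_trans (le_max_right _ _) r3
  -- consequences at the top value x
  have hx1 : x ≤ 1 := by
    have : Real.log x ≤ 0 := by linarith
    exact (Real.log_nonpos_iff hx.le).mp this
  have tβ : 2 * x ^ β ≤ 1 := mul_rpow_le_one_of_expThreshold_le hx hβ eβ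
  have t6 : 8 / Lr ^ 2 * x ^ (6 * eps) ≤ 1 := mul_rpow_le_one_of_expThreshold_le hx h6 e6
  have t3 : 16 * A * Lr * x ^ (1 / 4 - β - 4 * eps) ≤ 1 := mul_rpow_le_one_of_expThreshold_le hx hs1 e3
  have t4 : 8 * A * Lr ^ (3 - β) * x ^ (1 / 4 - β - 10 * eps) ≤ 1 := mul_rpow_le_one_of_expThreshold_le hx hs2 e4
  -- the L-clause j1: L^{β−3/2} ≤ L^{−1} ≤ 1/4
  have j1 : Lr ^ (β - 3 / 2) ≤ 1 / 4 := by
    have h1 : Lr ^ (β - 3 / 2) ≤ Lr ^ (-1 : ℝ) :=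
      Real.rpow_le_rpow_of_exponent_le hL1 (by linarith)
    have h2 : Lr ^ (-1 : ℝ) = Lr⁻¹ := Real.rpow_neg_one Lr
    rw [h2] at h1
    have h3 : Lr⁻¹ ≤ 1 / 4 := by rw [inv_eq_one_div]; exact one_div_le_one_div_of_le (by norm_num) hL4
    exact h1.trans h3
  have hL2 : 0 < Lr ^ 2 := by positivity
  -- per-level facts
  have key : ∀ k, k ≤ K →
      0 < lamSeq Lr x K k ∧ lamSeq Lr x K k ≤ 1 ∧ lamSeq Lr x K k ^ β ≤ 1 / 2 ∧
      (Lr ^ 2)⁻¹ * lamSeq Lr x K k ^ (6 * eps) ≤ 1 / 8 ∧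
      A * Lr * lamSeq Lr x K k ^ (1 / 4 - β - 4 * eps) ≤ 1 / 16 ∧
      A * Lr ^ (3 - β) * lamSeq Lr x K k ^ (1 / 4 - β - 10 * eps) ≤ 1 / 8 ∧
      A * Lr * lamSeq Lr x K k ^ (1 / 4 - 4 * eps) ≤ 1 / 16 ∧
      A * Lr ^ (3 - β) * lamSeq Lr x K k ^ (1 / 4 - 10 * eps) ≤ 1 / 8 := by
    intro k hk
    set y := lamSeq Lr x K k with hy
    have hy0 : 0 < y := lamSeq_pos hL0 hx K k
    have hyx : y ≤ x := lamSeq_le hL1 hx.le hk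
    have hy1 : y ≤ 1 := hyx.trans hx1
    have mono : ∀ s : ℝ, 0 ≤ s → y ^ s ≤ x ^ s := fun s hs => Real.rpow_le_rpow hy0.le hyx hs
    have hAL : 0 ≤ A * Lr := mul_nonneg hA hL0.le
    have hAL3 : 0 ≤ A * Lr ^ (3 - β) := mul_nonneg hA (Real.rpow_nonneg hL0.le _)
    have c_half : y ^ β ≤ 1 / 2 := by
      have := mono β hβ.le; linarith
    have c_6 : (Lr ^ 2)⁻¹ * y ^ (6 * eps) ≤ 1 / 8 := by
      have m := mono (6 * eps) h6.le
      have : (Lr ^ 2)⁻¹ * y ^ (6 * eps) ≤ (Lr ^ 2)⁻¹ * x ^ (6 * eps) :=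
        mul_le_mul_of_nonneg_left m (inv_nonneg.mpr hL2.le)
      have h' : 8 / Lr ^ 2 * x ^ (6 * eps) = 8 * ((Lr ^ 2)⁻¹ * x ^ (6 * eps)) := by ring
      rw [h'] at t6
      linarith
    have c_3 : A * Lr * y ^ (1 / 4 - β - 4 * eps) ≤ 1 / 16 := by
      have m := mono _ hs1.le
      have := mul_le_mul_of_nonneg_left m hAL
      linarith
    have c_4 : A * Lr ^ (3 - β) * y ^ (1 / 4 - β - 10 * eps) ≤ 1 / 8 := by
      have m := mono _ hs2.le
      have := mul_le_mul_of_nonneg_left m hAL3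
      linarith
    -- the two clauses without `−β` in the exponent: larger exponent, smaller power (y ≤ 1)
    have c_3' : A * Lr * y ^ (1 / 4 - 4 * eps) ≤ 1 / 16 := by
      have m : y ^ (1 / 4 - 4 * eps) ≤ y ^ (1 / 4 - β - 4 * eps) :=
        Real.rpow_le_rpow_of_exponent_ge hy0 hy1 (by linarith)
      have := mul_le_mul_of_nonneg_left m hAL
      linarith
    have c_4' : A * Lr ^ (3 - β) * y ^ (1 / 4 - 10 * eps) ≤ 1 / 8 := by
      have m : y ^ (1 / 4 - 10 * eps) ≤ y ^ (1 / 4 - β - 10 * eps) :=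
        Real.rpow_le_rpow_of_exponent_ge hy0 hy1 (by linarith)
      have := mul_le_mul_of_nonneg_left m hAL3
      linarith
    exact ⟨hy0, hy1, c_half, c_6, c_3, c_4, c_3', c_4'⟩
  exact
    { Lr_pos := hL0
      A_nonneg := hA
      β_pos := hβ
      lam_pos := fun k => lamSeq_pos hL0 hx K k
      lam_succ := fun k => lamSeq_succ hL0 K k
      lam_le_one := fun k hk => (key k hk).2.1
      half := fun k hk => (key k hk).2.2.1
      j1 := j1
      j2 := fun k hk => by have := (key k hk).2.2.2.1; linarith
      j3 := fun k hk => by have := (key k hk).2.2.2.2.1; linarith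
      e1 := by linarith
      e2 := fun k hk => by have := (key k hk).2.2.2.2.2.1; linarith
      c1 := fun k hk => by
        obtain ⟨-, -, -, h6', -, -, h3', -⟩ := key k hk
        linarith
      c2 := fun k hk => by
        obtain ⟨-, -, -, -, -, -, -, h4'⟩ := key k hk
        linarith }

/-- THE REGIME IS NON-EMPTY, in the print's order of quantifiers: for `0 < β`, `0 < ε`, `β + 10ε < 1/4`, `A ≥ 0`, every
`L ≥ L₀(β) := max(4, 4^{1/β})`, every `K` and every top value `0 < x ≤ exp(−ellFlow L A ε β)` there is a sequence with
`λ_K = x`, `λ_{k+1} = Lλ_k` satisfying `FlowSmall`. [cite: Dimock2013, §5 Theorem 24 (arXiv:1108.1335v2 TeX L3006–3016)] -/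
theorem exists_flowSmall {Lr A eps β x : ℝ} (K : ℕ) (hβ : 0 < β) (hε : 0 < eps) (hq : β + 10 * eps < 1 / 4)
    (hA : 0 ≤ A) (hL : max 4 ((4 : ℝ) ^ (1 / β)) ≤ Lr) (hx : 0 < x) (hxle : x ≤ Real.exp (-ellFlow Lr A eps β)) :
    ∃ lam : ℕ → ℝ, lam K = x ∧ FlowSmall lam Lr A eps β K := by
  have hL4 : 4 ≤ Lr := le_trans (le_max_left _ _) hL
  have hLβ : Lr ^ (-β) ≤ 1 / 4 := rpow_neg_le_quarter_of_le hβ (le_trans (le_max_right _ _) hL)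
  have hℓ : ellFlow Lr A eps β ≤ -Real.log x := le_neg_log_of_le_exp_neg hx hxle
  exact ⟨lamSeq Lr x K, lamSeq_top Lr x K, flowSmall_regime hβ hε hq hA hL4 hLβ hx hℓ⟩

/-! ## Part 3. Theorem 24 in the explicit regime -/

section Flow

variable {E : ℕ → Type*} [∀ k, NormedAddCommGroup (E k)] [∀ k, NormedSpace ℝ (E k)] [∀ k, CompleteSpace (E k)]

/-- **D1 THEOREM 24 IN THE EXPLICIT REGIME**: for `0 < β`, `0 < ε`, `β + 10ε < 1/4`, `A ≥ 0`, `L ≥ 4` with `L^{−β} ≤ 1/4`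
(e.g. `L ≥ 4^{1/β}`), a top value `0 < λ_K = x` with `−log x ≥ ellFlow L A ε β`, and ANY single step `S` obeying the
Theorem-14/Lemma-22 shapes `StepBounds S (lamSeq L x K) L A ε`, the counterterm flow with `μ_K = 0`, `E_0 = 0` exists and is
unique in the ball `|μ_k| ≤ λ_k^{1/2+β}`, `‖E_k‖ ≤ λ_k^β` — `SmallFieldFlow.flow_exists_unique` with its parameter hypothesis
DISCHARGED by `flowSmall_regime`. [cite: Dimock2013, §5 Theorem 24 (arXiv:1108.1335v2 TeX L3006–3016)] -/
theorem flow_exists_unique_regime (S : StepMaps E) {Lr A eps β x : ℝ} {K : ℕ}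
    (hβ : 0 < β) (hε : 0 < eps) (hq : β + 10 * eps < 1 / 4) (hA : 0 ≤ A) (hL4 : 4 ≤ Lr)
    (hLβ : Lr ^ (-β) ≤ 1 / 4) (hx : 0 < x) (hℓ : ellFlow Lr A eps β ≤ -Real.log x)
    (hB : StepBounds S (lamSeq Lr x K) Lr A eps) :
    ∃ μ : Fin (K + 1) → ℝ, ∃ Ek : (k : Fin (K + 1)) → E k.val,
      IsFlow S Lr K μ Ek ∧ InBall (lamSeq Lr x K) β K μ Ek ∧
        ∀ μ' : Fin (K + 1) → ℝ, ∀ Ek' : (k : Fin (K + 1)) → E k.val,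
          IsFlow S Lr K μ' Ek' → InBall (lamSeq Lr x K) β K μ' Ek' → μ' = μ ∧ Ek' = Ek :=
  flow_exists_unique hB (flowSmall_regime hβ hε hq hA hL4 hLβ hx hℓ)

end Flow

end Literature.MathematicalPhysics.QuantumFieldTheory.Dimock2011to13.SmallFieldFlowRegime

end
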